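import Summits.AtomisticToContinuum.FouriersLaw.Theorems.BondHeatUncertaintyExtensiveSnapshotIrreversibilityEnergyWindowOddMomentA

/-!
# Crux `ExtensiveSnapshotIrreversibility` (stmt-AtomisticToContinuum-9121), fixed-`N` half `K_fix`:
the energy-window seam with an `Lᵖ`-moment tail — filter form (node «OddLogRatioMomentLadder», part 1b/3)

(helper file, theorem-side; decomp-a2c lens-1, generation 88.)  Imports part 1a
(`…EnergyWindowOddMomentA`: `klDiv_flip_tilted_le_window_moment`, one tilted state, explicit
constants) and proves the filter form along a family `μ_δ = μ₀ · e^{φ_δ}`: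

* `klDiv_flip_le_of_energyWindow_moment` — (T1) `∫ e^{θW} dμ_δ ≤ C₁` + (T2ₚ)
  `∫ |φ_δ − φ_δ∘Θ|ᵖ dμ_δ ≤ C₂ |δ|^{−r}` (one Hölder exponent `p > 1`, ANY polynomial blow-up `r`) +
  (B1w) for every slack `a > 0` (a.e.) + (B2) give `KL(μ_δ ‖ Θ_*μ_δ) ≤ K δ²` eventually for every
  `K > D/2`: Young weight `λ = |δ|^{(r⁺+3)/p}`, window level `n ≥ 3 + (r⁺ + 3)q/p`, rate `κ = θ/n`,
  slack `a = κ/4`; both tail terms are `O(|δ|³)`, the bulk is `½(1 + O(√|δ|)) D' δ²`.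

No new objects. [folklore]  References: as in `…EnergyWindowTree`.
-/

noncomputable section

namespace Summit.AtomisticToContinuum.FouriersLaw.Theorems.ExtensiveSnapshotIrreversibility.EnergyWindow

open MeasureTheory Filter Topology InformationTheory Real
open scoped ENNReal NNReal
open Literature.MathematicalPhysics.KineticTheory.HeatConduction
open Summit.AtomisticToContinuum.FouriersLaw.Theorems.ExtensiveSnapshotIrreversibility.Negative
open Summit.AtomisticToContinuum.FouriersLaw.Theorems.ExtensiveSnapshotIrreversibility.ClausiusBudget.OddLogDensity

variable {N : ℕ}

section Seam

variable (μ₀ : Measure (PhaseSpace N)) [IsProbabilityMeasure μ₀]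

/-! ## 3. Along a family: `KL(μ_δ ‖ Θ_*μ_δ) ≤ K δ²` eventually, for every `K > D/2` -/
set_option maxHeartbeats 400000 in
/-- **Abstract energy-window seam with a moment tail (filter form).** For a family of tilts
`μ_δ = μ₀ · e^{φ_δ}` (`∫ e^{φ_δ} dμ₀ = 1` eventually in `δ ≠ 0`) of a flip-invariant probability
measure `μ₀` with a flip-invariant weight `W ≥ 0`, and Hölder conjugate `p, q`:
(T1) `∫ e^{θW} dμ_δ ≤ C₁`; (T2ₚ) the `Lᵖ(μ_δ)`-MOMENT of the odd log-density with polynomial blow-up,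
`∫ |φ_δ − φ_δ∘Θ|ᵖ dμ_δ ≤ C₂ |δ|^{−r}`; (B1w) for EVERY slack `a > 0` some `C₃, m` with
`e^{φ_δ} ≥ 1 − C₃|δ|(1 + W)^m e^{aW}` `μ₀`-a.e.; all eventually; and (B2)
`∫ (e^{φ_δ} − e^{φ_δ∘Θ})² dμ₀ ≤ D' δ²` eventually for every `D' > D` — imply
`KL(μ_δ ‖ Θ_*μ_δ) ≤ K δ²` eventually for every `K > D/2`
(`klDiv_flip_tilted_le_window_moment` with `u = √|δ|`, `λ = |δ|^{(r⁺+3)/p}`, level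
`n ≥ 3 + (r⁺ + 3)q/p`, rate `κ = θ/n`, slack `a = κ/4`: bulk `½(1 + O(√|δ|)) D' δ²`, tail `O(|δ|³)`).
[folklore] -/
theorem klDiv_flip_le_of_energyWindow_moment
    (hinv : μ₀.map (fun x : PhaseSpace N => (x.1, -x.2)) = μ₀)
    {W : PhaseSpace N → ℝ} (hWm : Measurable W) (hW0 : ∀ x, 0 ≤ W x)
    (hWflip : ∀ x : PhaseSpace N, W (x.1, -x.2) = W x)
    {θ C₁ C₂ r D p q : ℝ} (hpq : p.HolderConjugate q) (hθ : 0 < θ)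
    (φ : ℝ → PhaseSpace N → ℝ) (hφm : ∀ δ, Measurable (φ δ))
    (hZ : ∀ᶠ δ in 𝓝[≠] (0 : ℝ), Integrable (fun x => exp (φ δ x)) μ₀ ∧ ∫ x, exp (φ δ x) ∂μ₀ = 1)
    (hT1 : ∀ᶠ δ in 𝓝[≠] (0 : ℝ), Integrable (fun x => exp (θ * W x) * exp (φ δ x)) μ₀ ∧
      ∫ x, exp (θ * W x) * exp (φ δ x) ∂μ₀ ≤ C₁)
    (hT2 : ∀ᶠ δ in 𝓝[≠] (0 : ℝ),
      Integrable (fun x => |φ δ x - φ δ (x.1, -x.2)| ^ p * exp (φ δ x)) μ₀ ∧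
      ∫ x, |φ δ x - φ δ (x.1, -x.2)| ^ p * exp (φ δ x) ∂μ₀ ≤ C₂ * |δ| ^ (-r))
    (hB1 : ∀ a : ℝ, 0 < a → ∃ C₃ : ℝ, ∃ m : ℕ, ∀ᶠ δ in 𝓝[≠] (0 : ℝ), ∀ᵐ x ∂μ₀,
      1 - C₃ * |δ| * (1 + W x) ^ m * exp (a * W x) ≤ exp (φ δ x))
    (hB2 : ∀ D' : ℝ, D < D' → ∀ᶠ δ in 𝓝[≠] (0 : ℝ),
      Integrable (fun x => (exp (φ δ x) - exp (φ δ (x.1, -x.2))) ^ 2) μ₀ ∧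
      ∫ x, (exp (φ δ x) - exp (φ δ (x.1, -x.2))) ^ 2 ∂μ₀ ≤ D' * δ ^ 2) :
    ∀ K : ℝ, D / 2 < K → ∀ᶠ δ in 𝓝[≠] (0 : ℝ),
      klDiv (μ₀.tilted (φ δ)) ((μ₀.tilted (φ δ)).map (fun x : PhaseSpace N => (x.1, -x.2))) ≤
        ENNReal.ofReal (K * δ ^ 2) := by
  intro K hK
  set D' : ℝ := K + D / 2 with hD'
  have hDD' : D < D' := by rw [hD']; linarith
  have hgap : 0 < K - D' / 2 := by rw [hD']; linarith
  have hp : 0 < p := hpq.pos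
  have hq : 0 < q := hpq.symm.pos
  -- the exponents: blow-up `r⁺`, window level `n ≥ 3 + (r⁺ + 3) q / p`, rate `κ = θ/n`, slack `κ/4`
  set r' : ℝ := max r 0 with hr'
  have hr'0 : 0 ≤ r' := le_max_right _ _
  have hrr' : r ≤ r' := le_max_left _ _
  obtain ⟨n, hn⟩ : ∃ n : ℕ, 3 + (r' + 3) * q / p ≤ n := exists_nat_ge _
  have hn1 : (1 : ℝ) ≤ n := by
    have : 0 ≤ (r' + 3) * q / p := by positivity
    linarith
  have hnpos : (0 : ℝ) < n := by linarith
  set κ : ℝ := θ / n with hκ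
  have hκpos : 0 < κ := by rw [hκ]; positivity
  have hnκ : (n : ℝ) * κ ≤ θ := le_of_eq (by rw [hκ]; field_simp)
  set a : ℝ := κ / 4 with haκ
  have ha0 : 0 < a := by rw [haκ]; positivity
  have ha2 : 2 * a < κ := by rw [haκ]; linarith
  obtain ⟨C₃, m, hB1a⟩ := hB1 a ha0
  set C₃' : ℝ := max C₃ 0 with hC₃'
  have hC₃' : 0 ≤ C₃' := le_max_right _ _
  have hC₃le : C₃ ≤ C₃' := le_max_left _ _
  set C₂' : ℝ := max C₂ 0 with hC₂'
  have hC₂' : 0 ≤ C₂' := le_max_right _ _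
  have hC₂le : C₂ ≤ C₂' := le_max_left _ _
  set C₁' : ℝ := max C₁ 0 with hC₁'
  have hC₁' : 0 ≤ C₁' := le_max_right _ _
  have hC₁le : C₁ ≤ C₁' := le_max_left _ _
  set M' : ℝ := m.factorial * exp (κ / 2 - a) / (κ / 2 - a) ^ m with hM'
  have hM'pos : 0 < M' := by
    have : 0 < κ / 2 - a := by linarith
    rw [hM']
    positivity
  -- smallness events
  have t_abs : Tendsto (fun δ : ℝ => |δ|) (𝓝[≠] (0 : ℝ)) (𝓝 0) := by
    have h := (continuous_abs.tendsto (0 : ℝ))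
    rw [abs_zero] at h
    exact h.mono_left nhdsWithin_le_nhds
  have t_sqrt : Tendsto (fun δ : ℝ => Real.sqrt |δ|) (𝓝[≠] (0 : ℝ)) (𝓝 0) := by
    have h := (Real.continuous_sqrt.tendsto (0 : ℝ)).comp t_abs
    rw [Real.sqrt_zero] at h
    exact h
  have ev1 : ∀ᶠ δ in 𝓝[≠] (0 : ℝ), C₃' * M' * Real.sqrt |δ| < 1 / 2 := by
    have h := t_sqrt.const_mul (C₃' * M')
    rw [mul_zero] at h
    exact h.eventually_lt_const (by norm_num)
  have ev2 : ∀ᶠ δ in 𝓝[≠] (0 : ℝ), C₃' * M' * Real.sqrt |δ| * D' < (K - D' / 2) / 2 := by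
    have h := (t_sqrt.const_mul (C₃' * M')).mul_const D'
    rw [mul_zero, zero_mul] at h
    exact h.eventually_lt_const (by linarith)
  have ev3 : ∀ᶠ δ in 𝓝[≠] (0 : ℝ), (C₂' / p + C₁' / q) * |δ| < (K - D' / 2) / 2 := by
    have h := t_abs.const_mul (C₂' / p + C₁' / q)
    rw [mul_zero] at h
    exact h.eventually_lt_const (by linarith)
  have hone : ∀ᶠ δ in 𝓝[≠] (0 : ℝ), δ ≠ 0 ∧ |δ| < 1 := eventually_ne_and_abs_lt one_pos
  filter_upwards [hZ, hT1, hT2, hB1a, hB2 D' hDD', ev1, ev2, ev3, hone] with δ hZδ hT1δ hT2δ hB1δ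
    hB2δ h1 h2 h3 hδ
  have hδ0 : 0 < |δ| := abs_pos.2 hδ.1
  have hδ1 : |δ| < 1 := hδ.2
  set u : ℝ := Real.sqrt |δ| with hu
  have hupos : 0 < u := Real.sqrt_pos.2 hδ0
  have hu2 : u ^ 2 = |δ| := Real.sq_sqrt hδ0.le
  have hu2n : u ^ (2 * n) = |δ| ^ n := by rw [pow_mul, hu2]
  -- the Young weight `λ = |δ|^{(r⁺+3)/p}`
  set lam : ℝ := |δ| ^ ((r' + 3) / p) with hlam
  have hlampos : 0 < lam := by rw [hlam]; exact Real.rpow_pos_of_pos hδ0 _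
  have hlam_p : lam ^ p = |δ| ^ (r' + 3) := by
    rw [hlam, ← Real.rpow_mul hδ0.le]
    congr 1
    field_simp
  have hlam_q : (1 / lam) ^ q = |δ| ^ (-((r' + 3) * q / p)) := by
    rw [hlam, one_div, ← Real.rpow_neg hδ0.le, ← Real.rpow_mul hδ0.le]
    congr 1
    ring
  -- the floor in the seam's form
  have hB1' : ∀ᵐ x ∂μ₀, 1 - C₃' * u ^ 2 * (1 + W x) ^ m * exp (a * W x) ≤ exp (φ δ x) := by
    filter_upwards [hB1δ] with x hx
    have hnn : 0 ≤ u ^ 2 * (1 + W x) ^ m * exp (a * W x) := by have := hW0 x; positivity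
    rw [← hu2] at hx
    nlinarith [mul_le_mul_of_nonneg_right hC₃le hnn]
  have hmain := klDiv_flip_tilted_le_window_moment μ₀ hinv hWm hW0 hWflip (hφm δ) hZδ.1 hZδ.2 hpq
    ha2 hnκ hupos hlampos hC₃' hM'.symm.le hT1δ.1 hT1δ.2 hT2δ.1 hT2δ.2 hB1' hB2δ.1 hB2δ.2
    h1.le
  refine hmain.trans (ENNReal.ofReal_le_ofReal ?_)
  -- the two tail terms are `O(|δ|³)`
  have hA' : lam ^ p / p * (C₂ * |δ| ^ (-r)) ≤ C₂' / p * (|δ| * δ ^ 2) := by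
    rw [hlam_p]
    have h1' : C₂ * |δ| ^ (-r) ≤ C₂' * |δ| ^ (-r') :=
      calc C₂ * |δ| ^ (-r) ≤ C₂' * |δ| ^ (-r) :=
            mul_le_mul_of_nonneg_right hC₂le (Real.rpow_nonneg hδ0.le _)
        _ ≤ C₂' * |δ| ^ (-r') := mul_le_mul_of_nonneg_left
            (Real.rpow_le_rpow_of_exponent_ge hδ0 hδ1.le (neg_le_neg hrr')) hC₂'
    have h2' : |δ| ^ (r' + 3) * |δ| ^ (-r') = |δ| * δ ^ 2 := by
      rw [← Real.rpow_add hδ0]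
      have : r' + 3 + -r' = ((3 : ℕ) : ℝ) := by push_cast; ring
      rw [this, Real.rpow_natCast, ← sq_abs δ]
      ring
    have h3' : 0 ≤ |δ| ^ (r' + 3) / p := by positivity
    calc |δ| ^ (r' + 3) / p * (C₂ * |δ| ^ (-r)) ≤ |δ| ^ (r' + 3) / p * (C₂' * |δ| ^ (-r')) :=
          mul_le_mul_of_nonneg_left h1' h3'
      _ = C₂' / p * (|δ| ^ (r' + 3) * |δ| ^ (-r')) := by ring
      _ = C₂' / p * (|δ| * δ ^ 2) := by rw [h2']
  have hB' : (1 / lam) ^ q / q * C₁ * u ^ (2 * n) ≤ C₁' / q * (|δ| * δ ^ 2) := by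
    rw [hlam_q, hu2n]
    have h1' : |δ| ^ (-((r' + 3) * q / p)) * |δ| ^ n ≤ |δ| * δ ^ 2 := by
      rw [← Real.rpow_natCast |δ| n, ← Real.rpow_add hδ0]
      have h3' : ((3 : ℕ) : ℝ) ≤ -((r' + 3) * q / p) + n := by push_cast; linarith
      calc |δ| ^ (-((r' + 3) * q / p) + (n : ℝ)) ≤ |δ| ^ ((3 : ℕ) : ℝ) :=
            Real.rpow_le_rpow_of_exponent_ge hδ0 hδ1.le h3'
        _ = |δ| * δ ^ 2 := by rw [Real.rpow_natCast, ← sq_abs δ]; ring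
    have hnn : 0 ≤ |δ| ^ (-((r' + 3) * q / p)) * |δ| ^ n := by positivity
    calc |δ| ^ (-((r' + 3) * q / p)) / q * C₁ * |δ| ^ n
        = C₁ / q * (|δ| ^ (-((r' + 3) * q / p)) * |δ| ^ n) := by ring
      _ ≤ C₁' / q * (|δ| ^ (-((r' + 3) * q / p)) * |δ| ^ n) :=
          mul_le_mul_of_nonneg_right (div_le_div_of_nonneg_right hC₁le hq.le) hnn
      _ ≤ C₁' / q * (|δ| * δ ^ 2) := mul_le_mul_of_nonneg_left h1' (by positivity)
  have hsum : D' / 2 + C₃' * M' * u * D' + (C₂' / p + C₁' / q) * |δ| ≤ K := by linarith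
  have hδ2 : 0 ≤ δ ^ 2 := sq_nonneg δ
  have e : (1 / 2) * (1 + 2 * (C₃' * M' * u)) * (D' * δ ^ 2) + C₂' / p * (|δ| * δ ^ 2) +
      C₁' / q * (|δ| * δ ^ 2) = (D' / 2 + C₃' * M' * u * D' + (C₂' / p + C₁' / q) * |δ|) * δ ^ 2 := by
    ring
  have hfinal : (1 / 2) * (1 + 2 * (C₃' * M' * u)) * (D' * δ ^ 2) + C₂' / p * (|δ| * δ ^ 2) +
      C₁' / q * (|δ| * δ ^ 2) ≤ K * δ ^ 2 := by
    rw [e]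
    exact mul_le_mul_of_nonneg_right hsum hδ2
  linarith [hfinal, hA', hB']

end Seam

end Summit.AtomisticToContinuum.FouriersLaw.Theorems.ExtensiveSnapshotIrreversibility.EnergyWindow

end
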